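import Literature.NumberTheory.EllipticCurves.EisensteinNumbersPartialHeckeLTwist
import HarnessLib

/-!
# Sums over systems of ray-class representatives: independence of the system and transport under `𝔟 ↦ 𝔟₀·𝔟`

Topic `NumberTheory/LFunctions`; namespace `Literature.NumberTheory.LFunctions`.  Cell `bsd-print-cf2`, width seat
`bsd-line-cf2-p1-w5` g17, piece T-2 of the `j = 0` seam (assigned by the packager -w3 g31): in the twisted class-sum identity
(de Shalit II.4.14 (38)→(40)) the sum `Σ_{𝔟 ∈ T} F(𝔟)` over a system `T` of representatives of the ray classes mod `𝔪`
must be re-indexed by `𝔟 ↦ 𝔟₀·𝔟` for a fixed ideal `𝔟₀` prime to `𝔪` (the class of a Frobenius / of a conjugating `τ`).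
THIS FILE (theorems only, elementary): for a CLASS FUNCTION `F` (constant on ray classes of non-zero ideals prime to `𝔪`),

* ★ `IsRayClassReps.sum_eq_sum_of_rayClassRel` — `Σ_{𝔟∈T} F 𝔟 = Σ_{𝔟∈T′} F 𝔟` for ANY two systems `T, T′` (`Finset.sum_bij`
  along "the representative of the same class");
* ★ `IsRayClassReps.sum_mul_left_eq_sum` — `Σ_{𝔟∈T} F (𝔟₀·𝔟) = Σ_{𝔟∈T} F 𝔟` for `𝔟₀ ≠ 0` prime to `𝔪` (the translated
  system `𝔟₀·T` is again a system, tree `IsRayClassReps.image_mul`), and the `image` form `sum_image_mul_left_eq_sum`.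

HONEST FRAMING: bookkeeping on finite sums (Neukirch VI (1.8): the ray class group is a finite group, translation by a
class permutes it); nothing about `L`-functions or BSD is proved here.

## References
* [NeukirchANT1999] J. Neukirch, *Algebraic Number Theory* (1999), Ch. VI §1 Prop. (1.8).
* [deShalit1987] E. de Shalit, *Iwasawa theory of elliptic curves with complex multiplication* (1987), II.4.14 (38)–(40).
-/

noncomputable section

open IsDedekindDomain NumberField Finset

namespace Literature.NumberTheory.LFunctions

variable {K : Type*} [Field K] [NumberField K] {𝔪 : Ideal (𝓞 K)}

omit [NumberField K] in
/-- ★ **A class function has the same sum over any two systems of representatives** of the ray classes mod `𝔪`: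
if `F 𝔟 = F 𝔟′` whenever `𝔟 ∼ 𝔟′` (both non-zero and prime to `𝔪`), then `Σ_{𝔟∈T} F 𝔟 = Σ_{𝔟∈T′} F 𝔟`.
[cite: NeukirchANT1999, Ch. VI §1 Prop. (1.8)] -/
theorem IsRayClassReps.sum_eq_sum_of_rayClassRel {M : Type*} [AddCommMonoid M] {T T' : Finset (Ideal (𝓞 K))}
    (hT : IsRayClassReps 𝔪 T) (hT' : IsRayClassReps 𝔪 T') {F : Ideal (𝓞 K) → M}
    (hF : ∀ 𝔟 𝔟' : Ideal (𝓞 K), 𝔟 ≠ ⊥ → IsCoprime 𝔟 𝔪 → 𝔟' ≠ ⊥ → IsCoprime 𝔟' 𝔪 →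
      RayClassRel 𝔪 𝔟 𝔟' → F 𝔟 = F 𝔟') :
    ∑ 𝔟 ∈ T, F 𝔟 = ∑ 𝔟 ∈ T', F 𝔟 := by
  classical
  -- the representative in `T'` of the class of a non-zero ideal prime to `𝔪`
  have hrep : ∀ 𝔟 ∈ T, ∃ 𝔟' ∈ T', RayClassRel 𝔪 𝔟' 𝔟 := fun 𝔟 h𝔟 ↦
    hT'.exists_rel 𝔟 (hT.ne_bot_and_isCoprime 𝔟 h𝔟).1 (hT.ne_bot_and_isCoprime 𝔟 h𝔟).2
  choose! r hr hrel using hrep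
  refine Finset.sum_bij (fun 𝔟 h𝔟 ↦ r 𝔟) (fun 𝔟 h𝔟 ↦ hr 𝔟 h𝔟) ?_ ?_ ?_
  · -- injective: two members of `T` with the same representative in `T'` are related, hence equal
    intro 𝔟₁ h₁ 𝔟₂ h₂ heq
    have h12 : RayClassRel 𝔪 𝔟₁ 𝔟₂ :=
      (hrel 𝔟₁ h₁).symm.trans (by rw [heq]; exact hrel 𝔟₂ h₂)
    exact hT.eq_of_rel 𝔟₁ h₁ 𝔟₂ h₂ h12
  · -- surjective: a member of `T'` is the representative of the member of `T` in its class
    intro 𝔟' h𝔟'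
    obtain ⟨𝔟, h𝔟, hrel'⟩ :=
      hT.exists_rel 𝔟' (hT'.ne_bot_and_isCoprime 𝔟' h𝔟').1 (hT'.ne_bot_and_isCoprime 𝔟' h𝔟').2
    exact ⟨𝔟, h𝔟, hT'.eq_of_rel _ (hr 𝔟 h𝔟) _ h𝔟' ((hrel 𝔟 h𝔟).trans hrel')⟩
  · intro 𝔟 h𝔟
    exact hF 𝔟 (r 𝔟) (hT.ne_bot_and_isCoprime 𝔟 h𝔟).1 (hT.ne_bot_and_isCoprime 𝔟 h𝔟).2
      (hT'.ne_bot_and_isCoprime _ (hr 𝔟 h𝔟)).1 (hT'.ne_bot_and_isCoprime _ (hr 𝔟 h𝔟)).2 (hrel 𝔟 h𝔟).symm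

/-- Multiplication by a non-zero ideal is injective on ideals of a Dedekind domain, so `Σ_{𝔟' ∈ 𝔟₀·T} F 𝔟' = Σ_{𝔟∈T} F(𝔟₀𝔟)`.
[cite: NeukirchANT1999, Ch. VI §1 Prop. (1.8)] -/
theorem sum_image_mul_left {M : Type*} [AddCommMonoid M] [DecidableEq (Ideal (𝓞 K))] (T : Finset (Ideal (𝓞 K)))
    {𝔟₀ : Ideal (𝓞 K)} (h𝔟₀ : 𝔟₀ ≠ ⊥) (F : Ideal (𝓞 K) → M) :
    ∑ 𝔟' ∈ T.image (𝔟₀ * ·), F 𝔟' = ∑ 𝔟 ∈ T, F (𝔟₀ * 𝔟) :=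
  Finset.sum_image fun _ _ _ _ h ↦ mul_left_cancel₀ h𝔟₀ h

/-- ★ **Transport of a class sum under `𝔟 ↦ 𝔟₀·𝔟`**: for a system `T` of representatives mod `𝔪 ≠ 0`, `𝔟₀ ≠ 0` prime to
`𝔪`, and a class function `F`, `Σ_{𝔟∈T} F (𝔟₀·𝔟) = Σ_{𝔟∈T} F 𝔟` (the translated system `𝔟₀·T` is again a system of
representatives, `IsRayClassReps.image_mul`). [cite: NeukirchANT1999, Ch. VI §1 Prop. (1.8)] -/
theorem IsRayClassReps.sum_mul_left_eq_sum {M : Type*} [AddCommMonoid M] {T : Finset (Ideal (𝓞 K))}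
    (hT : IsRayClassReps 𝔪 T) (h𝔪 : 𝔪 ≠ ⊥) {𝔟₀ : Ideal (𝓞 K)} (h𝔟₀ : 𝔟₀ ≠ ⊥) (h𝔟₀cop : IsCoprime 𝔟₀ 𝔪)
    {F : Ideal (𝓞 K) → M}
    (hF : ∀ 𝔟 𝔟' : Ideal (𝓞 K), 𝔟 ≠ ⊥ → IsCoprime 𝔟 𝔪 → 𝔟' ≠ ⊥ → IsCoprime 𝔟' 𝔪 →
      RayClassRel 𝔪 𝔟 𝔟' → F 𝔟 = F 𝔟') :
    ∑ 𝔟 ∈ T, F (𝔟₀ * 𝔟) = ∑ 𝔟 ∈ T, F 𝔟 := by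
  classical
  rw [← sum_image_mul_left T h𝔟₀ F]
  exact (hT.image_mul h𝔪 h𝔟₀ h𝔟₀cop).sum_eq_sum_of_rayClassRel hT hF

/-- The `image` form: `Σ_{𝔟' ∈ 𝔟₀·T} F 𝔟' = Σ_{𝔟∈T} F 𝔟` for a class function `F` (the shape `T.image (v.asIdeal * ·)` of the
seam identity's `hST𝔭`). [cite: NeukirchANT1999, Ch. VI §1 Prop. (1.8)] -/
theorem IsRayClassReps.sum_image_mul_left_eq_sum {M : Type*} [AddCommMonoid M] [DecidableEq (Ideal (𝓞 K))]
    {T : Finset (Ideal (𝓞 K))} (hT : IsRayClassReps 𝔪 T) (h𝔪 : 𝔪 ≠ ⊥) {𝔟₀ : Ideal (𝓞 K)} (h𝔟₀ : 𝔟₀ ≠ ⊥)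
    (h𝔟₀cop : IsCoprime 𝔟₀ 𝔪) {F : Ideal (𝓞 K) → M}
    (hF : ∀ 𝔟 𝔟' : Ideal (𝓞 K), 𝔟 ≠ ⊥ → IsCoprime 𝔟 𝔪 → 𝔟' ≠ ⊥ → IsCoprime 𝔟' 𝔪 →
      RayClassRel 𝔪 𝔟 𝔟' → F 𝔟 = F 𝔟') :
    ∑ 𝔟' ∈ T.image (𝔟₀ * ·), F 𝔟' = ∑ 𝔟 ∈ T, F 𝔟 := by
  convert (hT.image_mul h𝔪 h𝔟₀ h𝔟₀cop).sum_eq_sum_of_rayClassRel hT hF using 2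

omit [NumberField K] in
/-- **Transport with a multiplicative weight**: if `F` is a class function and `w (𝔟₀ * 𝔟) = w 𝔟₀ * w 𝔟` on `T`, then
`Σ_{𝔟∈T} w(𝔟₀𝔟)·F(𝔟₀𝔟) = w(𝔟₀)·Σ_{𝔟∈T} w(𝔟)·F(𝔟₀ 𝔟)` — the factor `𝒲(𝔟_τ)` / `χ(g_𝔭)` pulled out of the re-indexed class
sum in (40). [cite: deShalit1987, II.4.14 (38)–(40) (p. 71–72)] -/
theorem sum_mul_weight_mul_left {R : Type*} [CommSemiring R] (T : Finset (Ideal (𝓞 K))) (𝔟₀ : Ideal (𝓞 K))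
    {w : Ideal (𝓞 K) → R} (hw : ∀ 𝔟 ∈ T, w (𝔟₀ * 𝔟) = w 𝔟₀ * w 𝔟) (F : Ideal (𝓞 K) → R) :
    ∑ 𝔟 ∈ T, w (𝔟₀ * 𝔟) * F (𝔟₀ * 𝔟) = w 𝔟₀ * ∑ 𝔟 ∈ T, w 𝔟 * F (𝔟₀ * 𝔟) := by
  rw [Finset.mul_sum]
  refine Finset.sum_congr rfl fun 𝔟 h𝔟 ↦ ?_
  rw [hw 𝔟 h𝔟, mul_assoc]

end Literature.NumberTheory.LFunctions

end
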